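import Mathlib
import Literature.NumberTheory.Transcendental.KZCalculus
import Literature.NumberTheory.Transcendental.KZLogCalculusProofs
import Summits.KontsevichZagierPeriods.KontsevichZagierPeriods.Theorems.TorsionLogsNeronTorsionSectorStubDlogUnfoldAux
import Summits.KontsevichZagierPeriods.KontsevichZagierPeriods.Theorems.TorsionLogsNeronTorsionSectorStubDlogUnfold
import Summits.KontsevichZagierPeriods.KontsevichZagierPeriods.Theorems.TorsionLogsNeronTorsionSectorStubLogStep
import HarnessLib

/-!
# Stub `stub_logB` — crux `TorsionLogs.NeronTorsionSector`, line `registered` (block V6):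
# the hard log at the corner `O`, upper side, in the chart `s = x^(-1/2)`

On the identity component of the real cubic `y² = f(x) = 4x³ − g₂x − g₃` we work entirely in the
chart `s = x^(-1/2)` at infinity, `s ∈ (0, s₁)` with `s₁² x₁ = 1`.  Two one-dimensional
Kontsevich–Zagier representations on `(0, s₁)` are compared:
`Θ₀ = [(0,s₁), Qh · 2/R]` (row `0`, lower branch) and `Θl = [(0,s₁), Qhp · 2/R]` (row `n − 1`,
upper branch), where `R > 0` is continuous and `ℚ`-semialgebraic on `[0, s₁]`
(`√f(s⁻²) = R(s)/s³`).  The chart conjugate `σ` of the upper translation is a bijection of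
`(0, s₁)` with the chart Haar identity `|σ′| · R = R ∘ σ`, and the chart dlog potential
`Gp = Gpx ∘ (s ↦ s⁻²)` satisfies, by the chain rule applied to `Gpx′ = Gpx · (Qf∘τp − Qfp)/ybp`
(`ybp = √f`), `Gp′ = −Gp · 2(Qh∘σ − Qhp)/R` on `(0, s₁)`.  We prove that `[Θ₀] − [Θl]` is, modulo
`KZ.relations`, a `ℤ`-combination of interval log carriers `[(αᵢ, βᵢ), dt/t]` whose values add up
to `log |Gp 0| − log |Gp s₁|`.

The chain of moves is that of `stub_logStep`:
1. rule (2) along `σ` (`of_sub_of_mem_relations_of_cov_fin_one`): `Θ₀ ≡ r₀ = [(0,s₁), (Qh∘σ)·2/R]`,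
   the Jacobian being the chart Haar identity; the absolute convergence of `r₀` is transported
   from that of `Θ₀` by `MeasureTheory.integrableOn_image_iff_integrableOn_abs_det_fderiv_smul`;
2. integrand additivity: `r₀ − Θl ≡ rD = [(0,s₁), (Qh∘σ − Qhp)·2/R]`;
3. on `(0, s₁)`, the integrand of `rD` is `−Gp′/Gp`; `Gp` has constant sign `sgn` on `[0, s₁]`,
   `|Gp| = sgn·Gp`, and `stub_dlogUnfold` applied to `[(0,s₁), (sgn Gp)′/(sgn Gp)] = −rD` unfolds
   it into interval log carriers with values summing to `log (|Gp s₁|/|Gp 0|)`;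
4. the signs of the coefficients are flipped.

References: M. Kontsevich, D. Zagier, *Periods* (2001), §1.2 rules (1)–(3); J. H. Silverman,
*The Arithmetic of Elliptic Curves* (2nd ed., 2009), III.5 (invariant differential).
-/

noncomputable section

-- `Summit.KontsevichZagierPeriods.KontsevichZagierPeriods.…` is the tree's mandated layout (single-conjunct summit).
set_option linter.dupNamespace false

open Set MeasureTheory Filter Topology
open Literature.NumberTheory.Transcendental Literature.ModelTheory.ExponentialFields
open Summit.KontsevichZagierPeriods.HyperbolicBloch.OffTetraSectorKernel (isSemialgebraic_logIvl)
open Summit.KontsevichZagierPeriods.HermiteRigidity.GenusTwoCycleTransfer (hasFDerivAt_fin_one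
  det_smul_id_fin_one)

namespace Summit.KontsevichZagierPeriods.KontsevichZagierPeriods.Cruxes.NeronTorsionSector.Translation

/-- **The chain rule in the chart `s = x^(-1/2)`.** If `Gp = Gpx ∘ (s ↦ s⁻²)` on `(0, s₁)`
(`s₁² x₁ = 1`), `Gpx′ = Gpx · (Qf∘τp − Qfp)/ybp` on `(x₁, ∞)` with `ybp = √f`,
`√f(s⁻²) = R(s)/s³`, `Qfp(s⁻²) = Qhp(s)` and `Qf(τp(s⁻²)) = Qh(σ s)`, then
`Gp′(s) = −Gp(s) · (Qh(σ s) − Qhp(s)) · 2/R(s)` for `s ∈ (0, s₁)`. [folklore] -/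
theorem logB_hasDerivAt_chart {x₁ s₁ : ℝ} {f ybp τp Qf Qfp Gpx R σ Qh Qhp Gp : ℝ → ℝ}
    (hsx : s₁ ^ 2 * x₁ = 1) (hybp : ybp = fun x => Real.sqrt (f x))
    (hR : ∀ s, 0 < s → s ≤ s₁ → Real.sqrt (f (s ^ 2)⁻¹) = R s / s ^ 3)
    (hchart : ∀ s, 0 < s → s < s₁ →
      Gp s = Gpx (s ^ 2)⁻¹ ∧ Qhp s = Qfp (s ^ 2)⁻¹ ∧ Qh (σ s) = Qf (τp (s ^ 2)⁻¹))
    (hRpos : ∀ s ∈ Icc 0 s₁, 0 < R s)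
    (hGpx : ∀ x, x₁ < x → HasDerivAt Gpx (Gpx x * ((Qf (τp x) - Qfp x) / ybp x)) x)
    {s : ℝ} (hs : s ∈ Ioo 0 s₁) :
    HasDerivAt Gp (-(Gp s * ((Qh (σ s) - Qhp s) * (2 / R s)))) s := by
  have hs0 : (0 : ℝ) < s := hs.1
  have hs2 : 0 < s ^ 2 := by positivity
  have hx : x₁ < (s ^ 2)⁻¹ := by
    rw [← inv_eq_of_mul_eq_one_right hsx]
    exact inv_strictAnti₀ hs2 (pow_lt_pow_left₀ hs.2 hs0.le two_ne_zero)
  obtain ⟨hG, hQ, hQσ⟩ := hchart s hs0 hs.2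
  have hinner : HasDerivAt (fun s : ℝ => (s ^ 2)⁻¹) (-(↑(2 : ℕ) * s ^ (2 - 1)) / (s ^ 2) ^ 2) s :=
    (hasDerivAt_pow 2 s).inv hs2.ne'
  have hcomp := (hGpx _ hx).comp s hinner
  have hev : Gp =ᶠ[𝓝 s] (Gpx ∘ fun s : ℝ => (s ^ 2)⁻¹) :=
    Filter.eventuallyEq_of_mem (Ioo_mem_nhds hs0 hs.2) fun y hy => (hchart y hy.1 hy.2).1
  refine (hcomp.congr_of_eventuallyEq hev).congr_deriv ?_
  have hybpx : ∀ x, ybp x = Real.sqrt (f x) := fun x => by rw [hybp]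
  rw [hybpx, hR s hs0 hs.2.le, ← hG, ← hQ, ← hQσ]
  have hR0 : R s ≠ 0 := (hRpos s ⟨hs0.le, hs.2.le⟩).ne'
  have hs0' : s ≠ 0 := hs0.ne'
  norm_num
  field_simp

/-- **STUB V6 (`stub_logB`, size L) — the hard log at the corner, upper side: `θ̃₀ − θ̃_{n−1} ≡ ∫ dlog`.**
In the chart at infinity: `Θ̂₀ = [(0,s₁), Q̂·2/R]` pulls back along the chart translation `σ` of the upper
branch (rule (2), `|σ′|R = R∘σ`, `σ((0,s₁)) = (0,s₁)`) to `[(0,s₁), Q̂(σ s)·2/R(s)]`; minus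
`Θ̂last = [(0,s₁), Q̂⁺·2/R]` (`Q̂⁺ = Qfp(s⁻²)`, bounded) the integrand `2(Q̂∘σ − Q̂⁺)/R` equals `−Ĝ⁺′/Ĝ⁺` for
the chart dlog potential `Ĝ⁺(s) = Gp(s⁻²)` of the upper branch (chain rule from `Gp′ = Gp·(Qf∘τp − Qfp)/ybp`,
`ybp = R/s³`, `Qf(τp(s⁻²)) = Q̂(σ s)`), continuous and non-vanishing on `[0,s₁]` (`stub_cornerChartUpper`:
`Ĝ⁺ = 4K̂⁺√T/E`); `stub_dlogUnfold` on `|Ĝ⁺|`. [cite: KontsevichZagier2001, §1.2 rules (2),(3)] -/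
theorem stub_logB :
    ∀ (g₂ g₃ x₁ s₁ Mb : ℝ) (f ybp τp Qf Qfp Gpx R σ Qh Qhp Gp : ℝ → ℝ)
      (Θ₀ Θl : Literature.NumberTheory.Transcendental.KZ.IntegralRep 1),
    (∀ x, f x = 4 * x ^ 3 - g₂ * x - g₃) →
    IsAlgebraic ℚ g₂ → IsAlgebraic ℚ g₃ → IsAlgebraic ℚ x₁ → IsAlgebraic ℚ s₁ →
    0 < x₁ → 0 < s₁ → s₁ ^ 2 * x₁ = 1 → (∀ x, x₁ ≤ x → 0 < f x) →
    ybp = (fun x => Real.sqrt (f x)) →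
    (∀ s, 0 < s → s ≤ s₁ → Real.sqrt (f (s ^ 2)⁻¹) = R s / s ^ 3) →
    (∀ s, 0 < s → s < s₁ → Gp s = Gpx (s ^ 2)⁻¹ ∧ Qhp s = Qfp (s ^ 2)⁻¹ ∧ Qh (σ s) = Qf (τp (s ^ 2)⁻¹)) →
    (∀ s ∈ Set.Icc 0 s₁, 0 < R s) → ContinuousOn R (Set.Icc 0 s₁) →
    IsSemialgebraicFunOn ℚ {t : Fin 1 → ℝ | t 0 ∈ Set.Icc 0 s₁} (fun t => R (t 0)) →
    (∀ s ∈ Set.Ioo 0 s₁, σ s ∈ Set.Ioo 0 s₁ ∧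
      ∃ σ' : ℝ, HasDerivAt σ σ' s ∧ σ' ≠ 0 ∧ |σ'| * R s = R (σ s)) →
    Set.InjOn σ (Set.Ioo 0 s₁) → σ '' Set.Ioo 0 s₁ = Set.Ioo 0 s₁ →
    ContinuousOn σ (Set.Icc 0 s₁) → Set.MapsTo σ (Set.Icc 0 s₁) (Set.Icc 0 s₁) →
    IsSemialgebraicFunOn ℚ {t : Fin 1 → ℝ | t 0 ∈ Set.Icc 0 s₁} (fun t => σ (t 0)) →
    ContinuousOn Qh (Set.Icc 0 s₁) →
    IsSemialgebraicFunOn ℚ {t : Fin 1 → ℝ | t 0 ∈ Set.Icc 0 s₁} (fun t => Qh (t 0)) →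
    IsSemialgebraicFunOn ℚ {t : Fin 1 → ℝ | t 0 ∈ Set.Icc 0 s₁} (fun t => Qh (σ (t 0))) →
    (∀ s ∈ Set.Ioo 0 s₁, |Qhp s| ≤ Mb) →
    IsSemialgebraicFunOn ℚ {t : Fin 1 → ℝ | t 0 ∈ Set.Ioo 0 s₁} (fun t => Qhp (t 0)) →
    (∀ x, x₁ < x → HasDerivAt Gpx (Gpx x * ((Qf (τp x) - Qfp x) / ybp x)) x) →
    ContinuousOn Gp (Set.Icc 0 s₁) → (∀ s ∈ Set.Icc 0 s₁, Gp s ≠ 0) →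
    IsSemialgebraicFunOn ℚ {t : Fin 1 → ℝ | t 0 ∈ Set.Icc 0 s₁} (fun t => Gp (t 0)) →
    Θ₀.domain = {t | 0 < t 0 ∧ t 0 < s₁} →
    Set.EqOn Θ₀.integrand (fun t => Qh (t 0) * (2 / R (t 0))) Θ₀.domain →
    Θl.domain = {t | 0 < t 0 ∧ t 0 < s₁} →
    Set.EqOn Θl.integrand (fun t => Qhp (t 0) * (2 / R (t 0))) Θl.domain →
    ∃ (κ : ℕ) (α β : Fin κ → ℝ) (ε : Fin κ → ℤ)
      (cs : Fin κ → Literature.NumberTheory.Transcendental.KZ.IntegralRep 1),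
      (∀ i, 0 < α i ∧ α i ≤ β i ∧ IsAlgebraic ℚ (α i) ∧ IsAlgebraic ℚ (β i) ∧
        (cs i).domain = {t | α i < t 0 ∧ t 0 < β i} ∧
        Set.EqOn (cs i).integrand (fun t => 1 / t 0) (cs i).domain) ∧
      ∑ i, (ε i : ℝ) * Real.log (β i / α i) = Real.log |Gp 0| - Real.log |Gp s₁| ∧
      Literature.NumberTheory.Transcendental.KZ.of Θ₀ - Literature.NumberTheory.Transcendental.KZ.of Θl
        - ∑ i, ε i • Literature.NumberTheory.Transcendental.KZ.of (cs i) ∈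
        Literature.NumberTheory.Transcendental.KZ.relations := by
  intro g₂ g₃ x₁ s₁ Mb f ybp τp Qf Qfp Gpx R σ Qh Qhp Gp Θ₀ Θl _hf _h₂ _h₃ _hx₁ hs₁a _hx₁0 hs₁0 hsx
    _hfpos hybp hR hchart hRpos _hRc hRσ hσ hσinj hσimg _hσc _hσmaps hσσ _hQhc _hQhσ hQhσσ _hMb hQhpσ
    hGpx hGpc hGp0 hGpσ hΘ₀d hΘ₀i hΘld hΘli
  /- ## Pointwise facts along the chart translation `σ` -/
  have hσd : ∀ s ∈ Ioo 0 s₁, HasDerivAt σ (deriv σ s) s := fun s hs => by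
    obtain ⟨-, σ', hσ', -, -⟩ := hσ s hs
    exact hσ'.differentiableAt.hasDerivAt
  have hσR : ∀ s ∈ Ioo 0 s₁, |deriv σ s| * R s = R (σ s) ∧ deriv σ s ≠ 0 := fun s hs => by
    obtain ⟨-, σ', hσ', hne, hRσ'⟩ := hσ s hs
    rw [hσ'.deriv]
    exact ⟨hRσ', hne⟩
  have hσI : ∀ s ∈ Ioo 0 s₁, σ s ∈ Ioo 0 s₁ := fun s hs => (hσ s hs).1
  -- the chain rule: `Gp′ = −Gp · (Qh∘σ − Qhp) · 2/R` on `(0, s₁)`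
  have hGpd : ∀ s ∈ Ioo 0 s₁, HasDerivAt Gp (-(Gp s * ((Qh (σ s) - Qhp s) * (2 / R s)))) s :=
    fun s hs => logB_hasDerivAt_chart hsx hybp hR hchart hRpos hGpx hs
  /- ## The slab `S = (0, s₁)` of `ℝ¹` and the semialgebraic functions on it -/
  set S : Set (Fin 1 → ℝ) := {t | 0 < t 0 ∧ t 0 < s₁} with hS
  have hSσ : IsSemialgebraic ℚ S := isSemialgebraic_logIvl isAlgebraic_zero hs₁a
  have hmeas : MeasurableSet S := IsSemialgebraic.measurableSet_holds hSσ
  have hIccσ : IsSemialgebraic ℚ {t : Fin 1 → ℝ | t 0 ∈ Icc 0 s₁} :=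
    IsSemialgebraicFunOn.isSemialgebraic_holds hGpσ
  have hsub : S ⊆ {t : Fin 1 → ℝ | t 0 ∈ Icc 0 s₁} := fun t ht => ⟨le_of_lt ht.1, le_of_lt ht.2⟩
  have hR_ne : ∀ t ∈ S, R (t 0) ≠ 0 := fun t ht => (hRpos _ (hsub ht)).ne'
  have hRS : IsSemialgebraicFunOn ℚ S (fun t => R (t 0)) := hRσ.mono hsub hSσ
  have hσS : IsSemialgebraicFunOn ℚ S (fun t => σ (t 0)) := hσσ.mono hsub hSσ
  have hQhσS : IsSemialgebraicFunOn ℚ S (fun t => Qh (σ (t 0))) := hQhσσ.mono hsub hSσ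
  have hQhpS : IsSemialgebraicFunOn ℚ S (fun t => Qhp (t 0)) := hQhpσ
  have hGpS : IsSemialgebraicFunOn ℚ S (fun t => Gp (t 0)) := hGpσ.mono hsub hSσ
  have h2 : IsSemialgebraicFunOn ℚ S (fun _ => (2 : ℝ)) :=
    (isSemialgebraicFunOn_ratCast hSσ 2).congr fun x _ => by norm_num
  have h2R : IsSemialgebraicFunOn ℚ S (fun t => 2 / R (t 0)) := h2.div hRS hR_ne
  have hr₀σ : IsSemialgebraicFunOn ℚ S (fun p => Qh (σ (p 0)) * (2 / R (p 0))) :=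
    IsSemialgebraicFunOn.mul_holds hQhσS h2R
  have hrDσ : IsSemialgebraicFunOn ℚ S (fun p => (Qh (σ (p 0)) - Qhp (p 0)) * (2 / R (p 0))) :=
    IsSemialgebraicFunOn.mul_holds (IsSemialgebraicFunOn.sub_holds hQhσS hQhpS) h2R
  -- the integrands of `Θ₀`, `Θl` on `S`
  have hmaps : MapsTo (fun (p : Fin 1 → ℝ) (_ : Fin 1) => σ (p 0)) S Θ₀.domain := fun p hp => by
    rw [hΘ₀d]
    exact hσI (p 0) hp
  have hΘ₀i' : ∀ p ∈ S, Θ₀.integrand (fun _ => σ (p 0)) = Qh (σ (p 0)) * (2 / R (σ (p 0))) :=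
    fun p hp => hΘ₀i (hmaps hp)
  have hΘli' : ∀ p ∈ S, Θl.integrand p = Qhp (p 0) * (2 / R (p 0)) := fun p hp =>
    hΘli (by rw [hΘld]; exact hp)
  /- ## Step 1: the pulled-back representation `r₀ = [(0,s₁), (Qh∘σ)·2/R]` and rule (2) -/
  have hinjΦ : InjOn (fun (p : Fin 1 → ℝ) (_ : Fin 1) => σ (p 0)) S := fun p hp q hq h => by
    have h0 : σ (p 0) = σ (q 0) := congr_fun h 0
    funext i
    rw [Fin.fin_one_eq_zero i]
    exact hσinj hp hq h0
  have himg : (fun (p : Fin 1 → ℝ) (_ : Fin 1) => σ (p 0)) '' S = Θ₀.domain := by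
    rw [hΘ₀d]
    exact image_slab_eq hσimg
  have hr₀_int : IntegrableOn (fun p : Fin 1 → ℝ => Qh (σ (p 0)) * (2 / R (p 0))) S := by
    have key : IntegrableOn Θ₀.integrand ((fun (p : Fin 1 → ℝ) (_ : Fin 1) => σ (p 0)) '' S) := by
      rw [himg]
      exact Θ₀.integrableOn
    have key' := (integrableOn_image_iff_integrableOn_abs_det_fderiv_smul volume hmeas
      (f' := fun p : Fin 1 → ℝ => deriv σ (p 0) • ContinuousLinearMap.id ℝ (Fin 1 → ℝ))
      (fun p hp => (hasFDerivAt_fin_one σ (deriv σ (p 0)) p (hσd (p 0) hp)).hasFDerivWithinAt)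
      hinjΦ Θ₀.integrand).1 key
    refine key'.congr_fun (fun p hp => ?_) hmeas
    show |(deriv σ (p 0) • ContinuousLinearMap.id ℝ (Fin 1 → ℝ)).det| •
        Θ₀.integrand (fun _ => σ (p 0)) = Qh (σ (p 0)) * (2 / R (p 0))
    rw [det_smul_id_fin_one, smul_eq_mul, hΘ₀i' p hp, ← (hσR (p 0) hp).1]
    have h1 : |deriv σ (p 0)| ≠ 0 := abs_ne_zero.2 (hσR (p 0) hp).2
    have h2 : R (p 0) ≠ 0 := hR_ne p hp
    field_simp
  obtain ⟨r₀, hr₀_d, hr₀_i⟩ : ∃ r : KZ.IntegralRep 1, r.domain = S ∧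
      r.integrand = fun p => Qh (σ (p 0)) * (2 / R (p 0)) :=
    ⟨⟨S, fun p => Qh (σ (p 0)) * (2 / R (p 0)), hSσ, hr₀σ, hr₀_int⟩, rfl, rfl⟩
  have hA : KZ.of r₀ - KZ.of Θ₀ ∈ KZ.relations := by
    refine of_sub_of_mem_relations_of_cov_fin_one (I := Ioo 0 s₁) r₀ Θ₀ hr₀_d
      (by rw [hr₀_d]; exact hσS) hσd hσinj (by rw [hΘ₀d, hσimg]; rfl) fun p hp => ?_
    rw [hr₀_d] at hp
    rw [hr₀_i, hΘ₀i' p hp, ← (hσR (p 0) hp).1]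
    have h1 : |deriv σ (p 0)| ≠ 0 := abs_ne_zero.2 (hσR (p 0) hp).2
    have h2 : R (p 0) ≠ 0 := hR_ne p hp
    field_simp
  /- ## Step 2: integrand additivity, `r₀ − Θl ≡ rD = [(0,s₁), (Qh∘σ − Qhp)·2/R]` -/
  have hrD_int : IntegrableOn
      (fun p : Fin 1 → ℝ => (Qh (σ (p 0)) - Qhp (p 0)) * (2 / R (p 0))) S := by
    have h₁ : IntegrableOn Θl.integrand S := by
      have h := Θl.integrableOn
      rwa [hΘld] at h
    refine (hr₀_int.sub h₁).congr_fun (fun p hp => ?_) hmeas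
    rw [Pi.sub_apply, hΘli' p hp]
    ring
  obtain ⟨rD, hrD_d, hrD_i⟩ : ∃ r : KZ.IntegralRep 1, r.domain = S ∧
      r.integrand = fun p => (Qh (σ (p 0)) - Qhp (p 0)) * (2 / R (p 0)) :=
    ⟨⟨S, _, hSσ, hrDσ, hrD_int⟩, rfl, rfl⟩
  have hB : KZ.of r₀ - KZ.of Θl - KZ.of rD ∈ KZ.relations := by
    refine KZ.integrandAddRel_subset_relations ⟨1, r₀, Θl, rD, by rw [hΘld, hr₀_d],
      by rw [hrD_d, hr₀_d], fun p hp => ?_, rfl⟩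
    rw [hr₀_d] at hp
    rw [Pi.add_apply, hr₀_i, hrD_i, hΘli' p hp]
    ring
  have hC : KZ.of rD + KZ.of rD.neg ∈ KZ.relations :=
    KZ.of_add_of_mem_relations_of_eqOn_neg rfl fun _ _ => rfl
  /- ## Step 3: `−rD = [(0,s₁), (sgn Gp)′/(sgn Gp)]` unfolds into interval logarithms -/
  obtain ⟨sgn, hs1, hspos⟩ := logStep_sign hs₁0.le hGpc hGp0
  have hsalg : IsAlgebraic ℚ sgn := by
    rcases hs1 with rfl | rfl
    · exact isAlgebraic_one
    · exact isAlgebraic_one.neg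
  have hsabs : |sgn| = 1 := by rcases hs1 with rfl | rfl <;> simp
  have habs : ∀ x ∈ Icc 0 s₁, |Gp x| = sgn * Gp x := fun x hx => by
    have h := abs_of_pos (hspos x hx)
    rwa [abs_mul, hsabs, one_mul] at h
  have hGpσ' : IsSemialgebraicFunOn ℚ {t : Fin 1 → ℝ | t 0 ∈ Icc 0 s₁} (fun t => sgn * Gp (t 0)) :=
    IsSemialgebraicFunOn.mul_holds (isSemialgebraicFunOn_const_of_isAlgebraic hIccσ hsalg) hGpσ
  have hGp'σ : IsSemialgebraicFunOn ℚ S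
      (fun t => sgn * -(Gp (t 0) * ((Qh (σ (t 0)) - Qhp (t 0)) * (2 / R (t 0))))) :=
    IsSemialgebraicFunOn.mul_holds (isSemialgebraicFunOn_const_of_isAlgebraic hSσ hsalg)
      (IsSemialgebraicFunOn.mul_holds hGpS hrDσ).neg
  have hGppos : ∀ x ∈ Icc 0 s₁, 0 < sgn * Gp x := hspos
  have hGpc' : ContinuousOn (fun x => sgn * Gp x) (Icc 0 s₁) := continuousOn_const.mul hGpc
  have hGpd' : ∀ x ∈ Ioo 0 s₁,
      HasDerivAt (fun x => sgn * Gp x) (sgn * -(Gp x * ((Qh (σ x) - Qhp x) * (2 / R x)))) x :=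
    fun x hx => (hGpd x hx).const_mul sgn
  have hnegd : rD.neg.domain = {t | 0 < t 0 ∧ t 0 < s₁} := by
    rw [KZ.IntegralRep.domain_neg, hrD_d]
  have hnegi : EqOn rD.neg.integrand
      (fun t => sgn * -(Gp (t 0) * ((Qh (σ (t 0)) - Qhp (t 0)) * (2 / R (t 0)))) /
        (sgn * Gp (t 0))) rD.neg.domain := fun p hp => by
    rw [hnegd] at hp
    have hsG : sgn * Gp (p 0) ≠ 0 := (hspos (p 0) (hsub hp)).ne'
    rw [KZ.IntegralRep.integrand_neg, Pi.neg_apply, hrD_i]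
    show -((Qh (σ (p 0)) - Qhp (p 0)) * (2 / R (p 0))) =
      sgn * -(Gp (p 0) * ((Qh (σ (p 0)) - Qhp (p 0)) * (2 / R (p 0)))) / (sgn * Gp (p 0))
    rw [mul_neg, ← mul_assoc, neg_div, mul_div_cancel_left₀ _ hsG]
  obtain ⟨κ, α, β, ε, cs, hcs, hlog, hrel⟩ := stub_dlogUnfold 0 s₁ (fun x => sgn * Gp x)
    (fun x => sgn * -(Gp x * ((Qh (σ x) - Qhp x) * (2 / R x)))) rD.neg hs₁0 isAlgebraic_zero hs₁a
    hGppos hGpc' hGpd' hGpσ' hGp'σ hnegd hnegi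
  /- ## Step 4: flip the signs and assemble -/
  refine ⟨κ, α, β, fun i => -ε i, cs, hcs, ?_, ?_⟩
  · have h0' : (0 : ℝ) ∈ Icc 0 s₁ := left_mem_Icc.2 hs₁0.le
    have h1' : s₁ ∈ Icc 0 s₁ := right_mem_Icc.2 hs₁0.le
    simp only [Int.cast_neg, neg_mul, Finset.sum_neg_distrib, hlog]
    rw [Real.log_div (hspos s₁ h1').ne' (hspos 0 h0').ne', habs 0 h0', habs s₁ h1']
    ring
  · simp only [neg_smul, Finset.sum_neg_distrib, sub_neg_eq_add]
    have e : KZ.of Θ₀ - KZ.of Θl + ∑ i, ε i • KZ.of (cs i) =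
        (KZ.of r₀ - KZ.of Θl - KZ.of rD) - (KZ.of r₀ - KZ.of Θ₀)
          + (KZ.of rD + KZ.of rD.neg) - (KZ.of rD.neg - ∑ i, ε i • KZ.of (cs i)) := by
      abel
    rw [e]
    exact KZ.relations.sub_mem (KZ.relations.add_mem (KZ.relations.sub_mem hB hA) hC) hrel

end Summit.KontsevichZagierPeriods.KontsevichZagierPeriods.Cruxes.NeronTorsionSector.Translation

end
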